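import Summits.QuantumFields.YangMills.Theorems.BalabanUVNodesN15CurvedGluingSpeciesCommutatorAdjointSandwich
import HarnessLib

/-!
# THE η-DEFECT OF THE ADJOINT SPECIES COMMUTATOR FROM SANDWICHED RIGHT ENTRIES — FILE 152's two-grid twin: dag-n15-w3 file 15 `hasMaj_idef_comp_commOp_speciesOpM` ∕ dag-n15-w5
# `hasMaj_idef_comp_commOp_speciesOpM_add` ∕ `hasMaj_idef_comp_commOp_dressedPert` with the right entries entering only SANDWICHED, `G∘∇^±_μ∘M_χ = T^±_μ∘M_χ`, at both grids
# (dag-n15-c g18, FILE 154; N15 = NE2, s1 «background-layer OPERATOR ingredient»)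

Cell `pub-ymgap`, seat `pub-ymgap-dag-n15-c` (R134 (a); HUMAN RULING D-0062), generation 18.  `bears_on: R4∕N15 · K3⁸ SpineGivenEndpointR13SepCoPHV (stmt-QuantumFields-27366)`.
Filed `--kind proof --supports stmt-QuantumFields-27366 --as helper` — COUNT-NEUTRAL.  Theorems only; 0 `def`, 0 `sorry`.  Imports BY NAME FILE 152 `…SpeciesCommutatorAdjointSandwich`
(`comp_mmulOp_smul_of_sandwich`; through it dag-n15-w3 file 15 `…SpeciesCommutatorAdjointDefect` (`hasMaj_idef_comp_mmulOp_loc`, `sum_abs_smul_row_fit_le`), file 14 (`comp_commOp_speciesOpM`,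
`sum_abs_smul_row_le`), dag-n15-w5 (`hasMaj_idef_comp_commOp_of_add`, `unstackM_add_base_comp_jet`), dag-n15-c FILE 56 (`hasMaj_commOp_nonlocal`, `hasMaj_idef_commOp_nonlocal`), FILE 45
`idef_fsum`).  Nothing in the tree is modified; nothing restated (w3∕w5's theorems are the unsandwiched editions).

WHY ∕ WHAT.  FILE 147∕149's `hDK` row (the two-grid defect of the adjoint remainder row) needs the η-defect of the species half `G∘[V(C,A) + N, M_h]`; dag-n15-w3 file 15 wrote it from the
right-entry DEFECTS `𝔇(G′∘∇′^±, G∘∇^±)` (unsandwiched).  As in FILE 152, file 14's identity puts only diagonal factors supported in the transition layers after the right entries, so at both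
grids `(G∘∇^±)∘M_{δh·A} = T^±∘M_{δh·A}` and the defect needs only the sandwiched operators' rows and defects `𝔇(T′^±, T^±)`: ★★ `hasMaj_idef_comp_commOp_speciesOpM_of_sandwich` (file 15's
constant with `m₁ :=` the sandwiched operators' defect letter), ★★ `hasMaj_idef_comp_commOp_speciesOpM_add_of_sandwich` (+ base part, w5's constant), ★ `hasMaj_idef_comp_commOp_dressedPert_of_sandwich`
(read on `(unstackM C A + N∘pr₀)∘jet` at both grids).

HONEST FRAMING ∕ LIMITS.  Block-majorant bookkeeping over DISPLAYED letters at both grids; proves NO estimate of any concrete propagator; nothing of [B5]∕[B6]∕[B9] asserted ((1.120)–(1.128),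
(2.133)–(2.134) p.247, (3.52) p.400, (3.76)–(3.77) pp.405–406 = SHAPES; Thm 3.14 pp.426–427 = difference TEMPLATE).  NE2⁺ NOT PRINTED, NOT proved; N15 NOT discharged; K3⁸ OPEN, skeleton v7
untouched (0∕2); counts of record UNMOVED by this seat (typed 28∕28 · discharged 7∕28 = 7∕27 excl. NODE O, №245); one finite 𝕋⁴ at fixed ε — NOT infinite volume, NOT OS on ℝ⁴, NOT a mass gap, NOT Clay; R4 closes the
conditional finite-𝕋⁴ rung `BalabanLadder.UV` only.  Restate-immune (no Theses import).
-/

set_option autoImplicit false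

noncomputable section
open scoped BigOperators
open Finset

namespace Summit.QuantumFields.YangMills.BalabanUVNodes.N15.Gluing

open Literature.MathematicalPhysics.QuantumFieldTheory.Balaban1983to89
open Literature.MathematicalPhysics.QuantumFieldTheory.Balaban1983to89.B11SectG (BlockNorm HasMaj RowSum)
open Literature.MathematicalPhysics.QuantumFieldTheory.Balaban1983to89.B6RandomWalk (Triangle254)
open Literature.MathematicalPhysics.QuantumFieldTheory.Balaban1983to89.T4EtaRateDefect (idef idef_comp idef_add idef_sub)
open Literature.MathematicalPhysics.QuantumFieldTheory.Balaban1983to89.T4EtaRateCoeffDefect (pull diagK diagK_nonneg)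
open Literature.MathematicalPhysics.QuantumFieldTheory.Balaban1983to89.B6Prop26Gluing (mulOp ind ind_nonneg)
open Summit.QuantumFields.YangMills.BalabanUVNodes.N15.MatrixSpecies (mmulOp liftMap liftBlk liftEquiv hasMaj_mmulOp hasMaj_idef_mmulOp)
open Summit.QuantumFields.YangMills.BalabanUVNodes.N15.BackgroundLayer (fgrad bgrad speciesOpM stack projO unstackM)
open Summit.QuantumFields.YangMills.BalabanUVNodes.N15.CurvedSpecies (comp_commOp_speciesOpM sum_abs_smul_row_le sum_abs_smul_row_fit_le hasMaj_idef_comp_mmulOp_loc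
  hasMaj_idef_comp_commOp_of_add unstackM_add_base_comp_jet)
open Summit.QuantumFields.YangMills.BalabanUVNodes.N15.Gluing (hasMaj_commOp_nonlocal hasMaj_idef_commOp_nonlocal)

variable {X X' ι J : Type} [Fintype X] [Fintype X'] [Fintype ι] [Fintype J] {g : B6.Geometry} (blk : X → g.Site) (π : X' → X) {σ cr : ℝ}
variable (τ : J → X ≃ X) (τ' : J → X' ≃ X') (n n' : ℝ) (C : X → Matrix ι ι ℝ) (C' : X' → Matrix ι ι ℝ) (A : J ⊕ J → X → Matrix ι ι ℝ) (A' : J ⊕ J → X' → Matrix ι ι ℝ)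
  (hX : X → ℝ) (hX' : X' → ℝ) (G : (X × ι → ℝ) →ₗ[ℝ] (X × ι → ℝ)) (G' : (X' × ι → ℝ) →ₗ[ℝ] (X' × ι → ℝ)) {χX : X → ℝ} {χX' : X' → ℝ}
  {TD TB : J → (X × ι → ℝ) →ₗ[ℝ] (X × ι → ℝ)} {TD' TB' : J → (X' × ι → ℝ) →ₗ[ℝ] (X' × ι → ℝ)}

/-- ★★ **THE η-DEFECT OF THE ADJOINT SPECIES COMMUTATOR FROM SANDWICHED RIGHT ENTRIES** — dag-n15-w3 file 15's `r_W` row with the right entries sandwiched at both grids: FINE partition letters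
`c₁, c₀`, partition fits `o₁, o₀`, COARSE coefficient rows `r_A`, translated fits `o_At`, FINE cube `G′ ≤ 1_S1_Sβ`, FINE sandwiched operators `T′^± ≤ 1_S1_Sβ₁`, defects `𝔇(G′,G) ≤ 1_S1_Sm₀`,
`𝔇(T′^±,T^±) ≤ 1_S1_Sm₁`, sandwiches `G∘∇^±∘M_χ = T^±∘M_χ` at both grids, transition layers of `h`, `h′` inside `{χ = 1}`, `{χ′ = 1}` ⟹
`𝔇(G′∘[V′, M_{h′}], G∘[V, M_h]) ≤ 1_S1_S·|J|·2(r_A(c₁m₀ + o₁β + c₀m₁ + o₀β₁) + o_At(c₁β + c₀β₁))·e^{−δd}`. [cite: Balaban1984PropagatorsII, (2.133)–(2.134) p.247 (shapes, transposed); Balaban1985BackgroundPropagators, (3.52) p.400, Thm 3.14 pp.426–427 (difference template)] -/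
theorem hasMaj_idef_comp_commOp_speciesOpM_of_sandwich {S : Set g.Site} {β β₁ c₁ c₀ o₁ o₀ m₀ m₁ rA oAt δ : ℝ} (hβ : 0 ≤ β) (hβ₁ : 0 ≤ β₁) (hc₁ : 0 ≤ c₁) (hc₀ : 0 ≤ c₀)
    (ho₁ : 0 ≤ o₁) (ho₀ : 0 ≤ o₀) (hm₀ : 0 ≤ m₀) (hm₁ : 0 ≤ m₁) (hrA : 0 ≤ rA) (hoAt : 0 ≤ oAt)
    (hh1 : ∀ μ x, |fgrad n (τ μ) hX x| ≤ c₁) (hh1b : ∀ μ x, |bgrad n (τ μ) hX x| ≤ c₁) (hh0 : ∀ μ x, |hX (τ μ x) - hX x| ≤ c₀)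
    (hh1' : ∀ μ x', |fgrad n' (τ' μ) hX' x'| ≤ c₁) (hh1b' : ∀ μ x', |bgrad n' (τ' μ) hX' x'| ≤ c₁) (hh0' : ∀ μ x', |hX' (τ' μ x') - hX' x'| ≤ c₀)
    (hf1 : ∀ μ x', |fgrad n' (τ' μ) hX' x' - fgrad n (τ μ) hX (π x')| ≤ o₁) (hf1b : ∀ μ x', |bgrad n' (τ' μ) hX' x' - bgrad n (τ μ) hX (π x')| ≤ o₁)
    (hf0 : ∀ μ x', |(hX' (τ' μ x') - hX' x') - (hX (τ μ (π x')) - hX (π x'))| ≤ o₀)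
    (hf0b : ∀ μ x', |(hX' x' - hX' ((τ' μ).symm x')) - (hX (π x') - hX ((τ μ).symm (π x')))| ≤ o₀)
    (hA : ∀ j x i, ∑ k, |A j x i k| ≤ rA)
    (hfAb : ∀ μ x' i, ∑ k, |A' (Sum.inl μ) ((τ' μ).symm x') i k - A (Sum.inl μ) ((τ μ).symm (π x')) i k| ≤ oAt)
    (hfAf : ∀ μ x' i, ∑ k, |A' (Sum.inr μ) (τ' μ x') i k - A (Sum.inr μ) (τ μ (π x')) i k| ≤ oAt)
    -- layers inside the cuts, sandwiches, at both grids
    (hδf : ∀ μ x, hX x - hX ((τ μ).symm x) ≠ 0 → χX x = 1) (hδb : ∀ μ x, hX (τ μ x) - hX x ≠ 0 → χX x = 1)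
    (hδf' : ∀ μ x', hX' x' - hX' ((τ' μ).symm x') ≠ 0 → χX' x' = 1) (hδb' : ∀ μ x', hX' (τ' μ x') - hX' x' ≠ 0 → χX' x' = 1)
    (hsD : ∀ μ, G ∘ₗ fgrad n (liftEquiv (τ μ) ι) ∘ₗ mulOp (fun p : X × ι => χX p.1) = TD μ ∘ₗ mulOp (fun p : X × ι => χX p.1))
    (hsB : ∀ μ, G ∘ₗ bgrad n (liftEquiv (τ μ) ι) ∘ₗ mulOp (fun p : X × ι => χX p.1) = TB μ ∘ₗ mulOp (fun p : X × ι => χX p.1))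
    (hsD' : ∀ μ, G' ∘ₗ fgrad n' (liftEquiv (τ' μ) ι) ∘ₗ mulOp (fun p : X' × ι => χX' p.1) = TD' μ ∘ₗ mulOp (fun p : X' × ι => χX' p.1))
    (hsB' : ∀ μ, G' ∘ₗ bgrad n' (liftEquiv (τ' μ) ι) ∘ₗ mulOp (fun p : X' × ι => χX' p.1) = TB' μ ∘ₗ mulOp (fun p : X' × ι => χX' p.1))
    -- fine rows, defects
    (hG' : HasMaj (BlockNorm.ofBlocks g (liftBlk blk ι ∘ liftMap π ι)) (BlockNorm.ofBlocks g (liftBlk blk ι ∘ liftMap π ι)) G'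
      (fun y y' => ind S y * ind S y' * (β * Real.exp (-(δ * g.dist y y')))))
    (hTD' : ∀ μ, HasMaj (BlockNorm.ofBlocks g (liftBlk blk ι ∘ liftMap π ι)) (BlockNorm.ofBlocks g (liftBlk blk ι ∘ liftMap π ι)) (TD' μ)
      (fun y y' => ind S y * ind S y' * (β₁ * Real.exp (-(δ * g.dist y y')))))
    (hTB' : ∀ μ, HasMaj (BlockNorm.ofBlocks g (liftBlk blk ι ∘ liftMap π ι)) (BlockNorm.ofBlocks g (liftBlk blk ι ∘ liftMap π ι)) (TB' μ)
      (fun y y' => ind S y * ind S y' * (β₁ * Real.exp (-(δ * g.dist y y')))))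
    (hDG : HasMaj (BlockNorm.ofBlocks g (liftBlk blk ι)) (BlockNorm.ofBlocks g (liftBlk blk ι ∘ liftMap π ι)) (idef (pull (liftMap π ι)) (pull (liftMap π ι)) G' G)
      (fun y y' => ind S y * ind S y' * (m₀ * Real.exp (-(δ * g.dist y y')))))
    (hDTD : ∀ μ, HasMaj (BlockNorm.ofBlocks g (liftBlk blk ι)) (BlockNorm.ofBlocks g (liftBlk blk ι ∘ liftMap π ι)) (idef (pull (liftMap π ι)) (pull (liftMap π ι)) (TD' μ) (TD μ))
      (fun y y' => ind S y * ind S y' * (m₁ * Real.exp (-(δ * g.dist y y')))))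
    (hDTB : ∀ μ, HasMaj (BlockNorm.ofBlocks g (liftBlk blk ι)) (BlockNorm.ofBlocks g (liftBlk blk ι ∘ liftMap π ι)) (idef (pull (liftMap π ι)) (pull (liftMap π ι)) (TB' μ) (TB μ))
      (fun y y' => ind S y * ind S y' * (m₁ * Real.exp (-(δ * g.dist y y'))))) :
    HasMaj (BlockNorm.ofBlocks g (liftBlk blk ι)) (BlockNorm.ofBlocks g (liftBlk blk ι ∘ liftMap π ι))
      (idef (pull (liftMap π ι)) (pull (liftMap π ι)) (G' ∘ₗ commOp (speciesOpM τ' n' C' A') (fun p' : X' × ι => hX' p'.1))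
        (G ∘ₗ commOp (speciesOpM τ n C A) (fun p : X × ι => hX p.1)))
      (fun y y' => ind S y * ind S y' * ((Fintype.card J * (2 * (rA * (c₁ * m₀ + o₁ * β + c₀ * m₁ + o₀ * β₁) + oAt * (c₁ * β + c₀ * β₁)))) * Real.exp (-(δ * g.dist y y')))) := by
  have hh0b : ∀ μ x, |hX x - hX ((τ μ).symm x)| ≤ c₀ := fun μ x => by simpa using hh0 μ ((τ μ).symm x)
  have hh0b' : ∀ μ x', |hX' x' - hX' ((τ' μ).symm x')| ≤ c₀ := fun μ x' => by simpa using hh0' μ ((τ' μ).symm x')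
  have r1 : ∀ μ x i, ∑ k, |(bgrad n (τ μ) hX x • A (Sum.inl μ) ((τ μ).symm x)) i k| ≤ c₁ * rA := fun μ x i => sum_abs_smul_row_le hc₁ (hh1b μ x) i (hA _ _ i)
  have r2 : ∀ μ x i, ∑ k, |((hX x - hX ((τ μ).symm x)) • A (Sum.inl μ) ((τ μ).symm x)) i k| ≤ c₀ * rA := fun μ x i => sum_abs_smul_row_le hc₀ (hh0b μ x) i (hA _ _ i)
  have r3 : ∀ μ x i, ∑ k, |(fgrad n (τ μ) hX x • A (Sum.inr μ) (τ μ x)) i k| ≤ c₁ * rA := fun μ x i => sum_abs_smul_row_le hc₁ (hh1 μ x) i (hA _ _ i)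
  have r4 : ∀ μ x i, ∑ k, |((hX (τ μ x) - hX x) • A (Sum.inr μ) (τ μ x)) i k| ≤ c₀ * rA := fun μ x i => sum_abs_smul_row_le hc₀ (hh0 μ x) i (hA _ _ i)
  have o1 : ∀ μ x' i, ∑ k, |(bgrad n' (τ' μ) hX' x' • A' (Sum.inl μ) ((τ' μ).symm x')) i k - (bgrad n (τ μ) hX (π x') • A (Sum.inl μ) ((τ μ).symm (π x'))) i k| ≤ c₁ * oAt + o₁ * rA :=
    fun μ x' i => sum_abs_smul_row_fit_le hc₁ (hh1b' μ x') i (hfAb μ x' i) (hf1b μ x') (hA _ _ i)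
  have o2 : ∀ μ x' i, ∑ k, |((hX' x' - hX' ((τ' μ).symm x')) • A' (Sum.inl μ) ((τ' μ).symm x')) i k - ((hX (π x') - hX ((τ μ).symm (π x'))) • A (Sum.inl μ) ((τ μ).symm (π x'))) i k| ≤
      c₀ * oAt + o₀ * rA := fun μ x' i => sum_abs_smul_row_fit_le hc₀ (hh0b' μ x') i (hfAb μ x' i) (hf0b μ x') (hA _ _ i)
  have o3 : ∀ μ x' i, ∑ k, |(fgrad n' (τ' μ) hX' x' • A' (Sum.inr μ) (τ' μ x')) i k - (fgrad n (τ μ) hX (π x') • A (Sum.inr μ) (τ μ (π x'))) i k| ≤ c₁ * oAt + o₁ * rA :=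
    fun μ x' i => sum_abs_smul_row_fit_le hc₁ (hh1' μ x') i (hfAf μ x' i) (hf1 μ x') (hA _ _ i)
  have o4 : ∀ μ x' i, ∑ k, |((hX' (τ' μ x') - hX' x') • A' (Sum.inr μ) (τ' μ x')) i k - ((hX (τ μ (π x')) - hX (π x')) • A (Sum.inr μ) (τ μ (π x'))) i k| ≤ c₀ * oAt + o₀ * rA :=
    fun μ x' i => sum_abs_smul_row_fit_le hc₀ (hh0' μ x') i (hfAf μ x' i) (hf0 μ x') (hA _ _ i)
  -- the sandwiches pass to the diagonal factors of the transition layers, at both grids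
  have eD : ∀ μ, (G ∘ₗ fgrad n (liftEquiv (τ μ) ι)) ∘ₗ mmulOp (fun x => (hX x - hX ((τ μ).symm x)) • A (Sum.inl μ) ((τ μ).symm x)) =
      TD μ ∘ₗ mmulOp (fun x => (hX x - hX ((τ μ).symm x)) • A (Sum.inl μ) ((τ μ).symm x)) := fun μ => comp_mmulOp_smul_of_sandwich (hsD μ) (hδf μ)
  have eB : ∀ μ, (G ∘ₗ bgrad n (liftEquiv (τ μ) ι)) ∘ₗ mmulOp (fun x => (hX (τ μ x) - hX x) • A (Sum.inr μ) (τ μ x)) =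
      TB μ ∘ₗ mmulOp (fun x => (hX (τ μ x) - hX x) • A (Sum.inr μ) (τ μ x)) := fun μ => comp_mmulOp_smul_of_sandwich (hsB μ) (hδb μ)
  have eD' : ∀ μ, (G' ∘ₗ fgrad n' (liftEquiv (τ' μ) ι)) ∘ₗ mmulOp (fun x' => (hX' x' - hX' ((τ' μ).symm x')) • A' (Sum.inl μ) ((τ' μ).symm x')) =
      TD' μ ∘ₗ mmulOp (fun x' => (hX' x' - hX' ((τ' μ).symm x')) • A' (Sum.inl μ) ((τ' μ).symm x')) := fun μ => comp_mmulOp_smul_of_sandwich (hsD' μ) (hδf' μ)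
  have eB' : ∀ μ, (G' ∘ₗ bgrad n' (liftEquiv (τ' μ) ι)) ∘ₗ mmulOp (fun x' => (hX' (τ' μ x') - hX' x') • A' (Sum.inr μ) (τ' μ x')) =
      TB' μ ∘ₗ mmulOp (fun x' => (hX' (τ' μ x') - hX' x') • A' (Sum.inr μ) (τ' μ x')) := fun μ => comp_mmulOp_smul_of_sandwich (hsB' μ) (hδb' μ)
  have hterm : ∀ μ, HasMaj (BlockNorm.ofBlocks g (liftBlk blk ι)) (BlockNorm.ofBlocks g (liftBlk blk ι ∘ liftMap π ι))
      (idef (pull (liftMap π ι)) (pull (liftMap π ι))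
        (G' ∘ₗ mmulOp (fun x' => bgrad n' (τ' μ) hX' x' • A' (Sum.inl μ) ((τ' μ).symm x')) +
            (G' ∘ₗ fgrad n' (liftEquiv (τ' μ) ι)) ∘ₗ mmulOp (fun x' => (hX' x' - hX' ((τ' μ).symm x')) • A' (Sum.inl μ) ((τ' μ).symm x')) +
          (G' ∘ₗ mmulOp (fun x' => fgrad n' (τ' μ) hX' x' • A' (Sum.inr μ) (τ' μ x')) -
            (G' ∘ₗ bgrad n' (liftEquiv (τ' μ) ι)) ∘ₗ mmulOp (fun x' => (hX' (τ' μ x') - hX' x') • A' (Sum.inr μ) (τ' μ x'))))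
        (G ∘ₗ mmulOp (fun x => bgrad n (τ μ) hX x • A (Sum.inl μ) ((τ μ).symm x)) +
            (G ∘ₗ fgrad n (liftEquiv (τ μ) ι)) ∘ₗ mmulOp (fun x => (hX x - hX ((τ μ).symm x)) • A (Sum.inl μ) ((τ μ).symm x)) +
          (G ∘ₗ mmulOp (fun x => fgrad n (τ μ) hX x • A (Sum.inr μ) (τ μ x)) -
            (G ∘ₗ bgrad n (liftEquiv (τ μ) ι)) ∘ₗ mmulOp (fun x => (hX (τ μ x) - hX x) • A (Sum.inr μ) (τ μ x)))))
      (fun y y' => ind S y * ind S y' * ((2 * (rA * (c₁ * m₀ + o₁ * β + c₀ * m₁ + o₀ * β₁) + oAt * (c₁ * β + c₀ * β₁))) * Real.exp (-(δ * g.dist y y')))) := fun μ => by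
    have t1 := hasMaj_idef_comp_mmulOp_loc blk π hβ (by positivity) hm₀ (by positivity) (r1 μ) (o1 μ) hG' hDG
    have t2 := hasMaj_idef_comp_mmulOp_loc blk π hβ₁ (by positivity) hm₁ (by positivity) (r2 μ) (o2 μ) (hTD' μ) (hDTD μ)
    have t3 := hasMaj_idef_comp_mmulOp_loc blk π hβ (by positivity) hm₀ (by positivity) (r3 μ) (o3 μ) hG' hDG
    have t4 := hasMaj_idef_comp_mmulOp_loc blk π hβ₁ (by positivity) hm₁ (by positivity) (r4 μ) (o4 μ) (hTB' μ) (hDTB μ)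
    rw [eD μ, eB μ, eD' μ, eB' μ, idef_add, idef_add, idef_sub]
    refine ((t1.add t2).add (t3.sub t4)).mono fun y y' => le_of_eq ?_
    ring
  rw [comp_commOp_speciesOpM, comp_commOp_speciesOpM, idef_fsum]
  refine (hasMaj_fsum (b₁ := BlockNorm.ofBlocks g (liftBlk blk ι)) (b₃ := BlockNorm.ofBlocks g (liftBlk blk ι ∘ liftMap π ι)) Finset.univ _ _
    fun μ _ => hterm μ).mono fun y y' => le_of_eq ?_
  simp only [Finset.sum_const, Finset.card_univ, nsmul_eq_mul]
  ring

/-- ★★ **THE η-DEFECT OF THE ADJOINT ROW OF `V(C,A) + N` FROM SANDWICHED RIGHT ENTRIES, OUTPUT-LOCALIZED** (dag-n15-w5 `hasMaj_idef_comp_commOp_speciesOpM_add`'s sandwich edition; FILE 147∕149's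
`hDK` species+base half): ★★ above + FILE 56's defect of `[N, M_h]` + the cube's defect through the coarse `[N, M_h]` (w5 `hasMaj_idef_comp_commOp_of_add`). [cite: Balaban1984PropagatorsI, (1.120) p.37, (1.128) p.38, p.39; Balaban1984PropagatorsII, (2.133)–(2.134) p.247 (shapes, transposed); Balaban1985BackgroundPropagators, (3.52) p.400, Thm 3.14 pp.426–427 (difference template)] -/
theorem hasMaj_idef_comp_commOp_speciesOpM_add_of_sandwich (htri : Triangle254 g) (hd : ∀ a b : g.Site, 0 ≤ g.dist a b) (hsymm : ∀ y y', g.dist y y' = g.dist y' y) (hrow : RowSum g σ cr)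
    (hσ : 0 ≤ σ) {N : (X × ι → ℝ) →ₗ[ℝ] (X × ι → ℝ)} {N' : (X' × ι → ℝ) →ₗ[ℝ] (X' × ι → ℝ)} {S : Set g.Site} {hb : g.Site → ℝ}
    {β β₁ c₁ c₀ o₁ o₀ m₀ m₁ rA oAt cN rN o δ δN ε ℓ ω ρ : ℝ} (hβ : 0 ≤ β) (hβ₁ : 0 ≤ β₁) (hc₁ : 0 ≤ c₁) (hc₀ : 0 ≤ c₀) (ho₁ : 0 ≤ o₁) (ho₀ : 0 ≤ o₀) (hm₀ : 0 ≤ m₀)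
    (hm₁ : 0 ≤ m₁) (hrA : 0 ≤ rA) (hoAt : 0 ≤ oAt) (hcN : 0 ≤ cN) (hrN : 0 ≤ rN) (ho : 0 ≤ o) (hℓ : 0 ≤ ℓ) (hω : 0 ≤ ω) (hε : 0 < ε) (hρ : 0 ≤ ρ) (hρN : ρ ≤ δN - ε)
    (hρδ : ρ + σ ≤ δ)
    (hh1 : ∀ μ x, |fgrad n (τ μ) hX x| ≤ c₁) (hh1b : ∀ μ x, |bgrad n (τ μ) hX x| ≤ c₁) (hh0 : ∀ μ x, |hX (τ μ x) - hX x| ≤ c₀)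
    (hh1' : ∀ μ x', |fgrad n' (τ' μ) hX' x'| ≤ c₁) (hh1b' : ∀ μ x', |bgrad n' (τ' μ) hX' x'| ≤ c₁) (hh0' : ∀ μ x', |hX' (τ' μ x') - hX' x'| ≤ c₀)
    (hf1 : ∀ μ x', |fgrad n' (τ' μ) hX' x' - fgrad n (τ μ) hX (π x')| ≤ o₁) (hf1b : ∀ μ x', |bgrad n' (τ' μ) hX' x' - bgrad n (τ μ) hX (π x')| ≤ o₁)
    (hf0 : ∀ μ x', |(hX' (τ' μ x') - hX' x') - (hX (τ μ (π x')) - hX (π x'))| ≤ o₀)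
    (hf0b : ∀ μ x', |(hX' x' - hX' ((τ' μ).symm x')) - (hX (π x') - hX ((τ μ).symm (π x')))| ≤ o₀)
    (hfit : ∀ x', |hX' x' - hX (π x')| ≤ o) (hLip : ∀ y y', |hb y - hb y'| ≤ ℓ * g.dist y y') (hrh : ∀ x, |hX x - hb (blk x)| ≤ ω) (hrh' : ∀ x', |hX' x' - hb (blk (π x'))| ≤ ω)
    (hA : ∀ j x i, ∑ k, |A j x i k| ≤ rA)
    (hfAb : ∀ μ x' i, ∑ k, |A' (Sum.inl μ) ((τ' μ).symm x') i k - A (Sum.inl μ) ((τ μ).symm (π x')) i k| ≤ oAt)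
    (hfAf : ∀ μ x' i, ∑ k, |A' (Sum.inr μ) (τ' μ x') i k - A (Sum.inr μ) (τ μ (π x')) i k| ≤ oAt)
    (hδf : ∀ μ x, hX x - hX ((τ μ).symm x) ≠ 0 → χX x = 1) (hδb : ∀ μ x, hX (τ μ x) - hX x ≠ 0 → χX x = 1)
    (hδf' : ∀ μ x', hX' x' - hX' ((τ' μ).symm x') ≠ 0 → χX' x' = 1) (hδb' : ∀ μ x', hX' (τ' μ x') - hX' x' ≠ 0 → χX' x' = 1)
    (hsD : ∀ μ, G ∘ₗ fgrad n (liftEquiv (τ μ) ι) ∘ₗ mulOp (fun p : X × ι => χX p.1) = TD μ ∘ₗ mulOp (fun p : X × ι => χX p.1))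
    (hsB : ∀ μ, G ∘ₗ bgrad n (liftEquiv (τ μ) ι) ∘ₗ mulOp (fun p : X × ι => χX p.1) = TB μ ∘ₗ mulOp (fun p : X × ι => χX p.1))
    (hsD' : ∀ μ, G' ∘ₗ fgrad n' (liftEquiv (τ' μ) ι) ∘ₗ mulOp (fun p : X' × ι => χX' p.1) = TD' μ ∘ₗ mulOp (fun p : X' × ι => χX' p.1))
    (hsB' : ∀ μ, G' ∘ₗ bgrad n' (liftEquiv (τ' μ) ι) ∘ₗ mulOp (fun p : X' × ι => χX' p.1) = TB' μ ∘ₗ mulOp (fun p : X' × ι => χX' p.1))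
    (hG' : HasMaj (BlockNorm.ofBlocks g (liftBlk blk ι ∘ liftMap π ι)) (BlockNorm.ofBlocks g (liftBlk blk ι ∘ liftMap π ι)) G'
      (fun y y' => ind S y * ind S y' * (β * Real.exp (-(δ * g.dist y y')))))
    (hTD' : ∀ μ, HasMaj (BlockNorm.ofBlocks g (liftBlk blk ι ∘ liftMap π ι)) (BlockNorm.ofBlocks g (liftBlk blk ι ∘ liftMap π ι)) (TD' μ)
      (fun y y' => ind S y * ind S y' * (β₁ * Real.exp (-(δ * g.dist y y')))))
    (hTB' : ∀ μ, HasMaj (BlockNorm.ofBlocks g (liftBlk blk ι ∘ liftMap π ι)) (BlockNorm.ofBlocks g (liftBlk blk ι ∘ liftMap π ι)) (TB' μ)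
      (fun y y' => ind S y * ind S y' * (β₁ * Real.exp (-(δ * g.dist y y')))))
    (hDG : HasMaj (BlockNorm.ofBlocks g (liftBlk blk ι)) (BlockNorm.ofBlocks g (liftBlk blk ι ∘ liftMap π ι)) (idef (pull (liftMap π ι)) (pull (liftMap π ι)) G' G)
      (fun y y' => ind S y * ind S y' * (m₀ * Real.exp (-(δ * g.dist y y')))))
    (hDTD : ∀ μ, HasMaj (BlockNorm.ofBlocks g (liftBlk blk ι)) (BlockNorm.ofBlocks g (liftBlk blk ι ∘ liftMap π ι)) (idef (pull (liftMap π ι)) (pull (liftMap π ι)) (TD' μ) (TD μ))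
      (fun y y' => ind S y * ind S y' * (m₁ * Real.exp (-(δ * g.dist y y')))))
    (hDTB : ∀ μ, HasMaj (BlockNorm.ofBlocks g (liftBlk blk ι)) (BlockNorm.ofBlocks g (liftBlk blk ι ∘ liftMap π ι)) (idef (pull (liftMap π ι)) (pull (liftMap π ι)) (TB' μ) (TB μ))
      (fun y y' => ind S y * ind S y' * (m₁ * Real.exp (-(δ * g.dist y y')))))
    (hN : HasMaj (BlockNorm.ofBlocks g (liftBlk blk ι)) (BlockNorm.ofBlocks g (liftBlk blk ι)) N (fun y y' => cN * Real.exp (-(δN * g.dist y y'))))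
    (hN' : HasMaj (BlockNorm.ofBlocks g (liftBlk blk ι ∘ liftMap π ι)) (BlockNorm.ofBlocks g (liftBlk blk ι ∘ liftMap π ι)) N' (fun y y' => cN * Real.exp (-(δN * g.dist y y'))))
    (hDN : HasMaj (BlockNorm.ofBlocks g (liftBlk blk ι)) (BlockNorm.ofBlocks g (liftBlk blk ι ∘ liftMap π ι)) (idef (pull (liftMap π ι)) (pull (liftMap π ι)) N' N)
      (fun y y' => rN * Real.exp (-(δN * g.dist y y')))) :
    HasMaj (BlockNorm.ofBlocks g (liftBlk blk ι)) (BlockNorm.ofBlocks g (liftBlk blk ι ∘ liftMap π ι))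
      (idef (pull (liftMap π ι)) (pull (liftMap π ι)) (G' ∘ₗ commOp (speciesOpM τ' n' C' A' + N') (fun p' : X' × ι => hX' p'.1))
        (G ∘ₗ commOp (speciesOpM τ n C A + N) (fun p : X × ι => hX p.1)))
      (fun y y' => ind S y * ((Fintype.card J * (2 * (rA * (c₁ * m₀ + o₁ * β + c₀ * m₁ + o₀ * β₁) + oAt * (c₁ * β + c₀ * β₁))) +
          β * (((ℓ * (Real.exp 1 * ε)⁻¹ + 2 * ω) * rN + 2 * o * cN)) * cr + m₀ * ((ℓ * (Real.exp 1 * ε)⁻¹ + 2 * ω) * cN) * cr) * Real.exp (-(ρ * g.dist y y')))) := by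
  have hDloc := hasMaj_idef_comp_commOp_speciesOpM_of_sandwich blk π τ τ' n n' C C' A A' hX hX' G G' hβ hβ₁ hc₁ hc₀ ho₁ ho₀ hm₀ hm₁ hrA hoAt hh1 hh1b hh0 hh1' hh1b' hh0' hf1 hf1b hf0 hf0b
    hA hfAb hfAf hδf hδb hδf' hδb' hsD hsB hsD' hsB' hG' hTD' hTB' hDG hDTD hDTB
  have hKN := hasMaj_commOp_nonlocal (liftBlk blk ι) (h := fun p : X × ι => hX p.1) hcN hℓ hω hε hd hsymm hLip (fun p => hrh p.1) hN
  have hDKN := hasMaj_idef_commOp_nonlocal (liftBlk blk ι) (liftMap π ι) (h := fun p : X × ι => hX p.1) (h' := fun p' : X' × ι => hX' p'.1) hcN hrN hℓ hω ho hε hd hsymm hLip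
    (fun p => hrh p.1) (fun p' => hrh' p'.1) (fun p' => hfit p'.1) hN hN' hDN
  have hr₁ : 0 ≤ Fintype.card J * (2 * (rA * (c₁ * m₀ + o₁ * β + c₀ * m₁ + o₀ * β₁) + oAt * (c₁ * β + c₀ * β₁))) := by positivity
  have hcK : 0 ≤ (ℓ * (Real.exp 1 * ε)⁻¹ + 2 * ω) * cN := by positivity
  have hrK : 0 ≤ (ℓ * (Real.exp 1 * ε)⁻¹ + 2 * ω) * rN + 2 * o * cN := by positivity
  exact hasMaj_idef_comp_commOp_of_add (liftBlk blk ι) (liftMap π ι) htri hd hrow hσ hr₁ hβ hm₀ hcK hrK hρ hρN hρδ hDloc hG' hDG hKN hDKN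

/-- ★ **… READ ON THE DRESSED PERTURBATIONS** `𝒱 = (unstackM C A + N∘pr₀)∘jet`, `𝒱′` (w5 `unstackM_add_base_comp_jet` at both grids) — FILE 147∕149's `hDK` species+base half for the
adjoint-side dressed cubes. [cite: Balaban1985BackgroundPropagators, (3.52) p.400, (3.62)–(3.65) pp.402–403, Thm 3.14 pp.426–427] -/
theorem hasMaj_idef_comp_commOp_dressedPert_of_sandwich [DecidableEq ι] [DecidableEq J] (htri : Triangle254 g) (hd : ∀ a b : g.Site, 0 ≤ g.dist a b)
    (hsymm : ∀ y y', g.dist y y' = g.dist y' y) (hrow : RowSum g σ cr) (hσ : 0 ≤ σ) {N : (X × ι → ℝ) →ₗ[ℝ] (X × ι → ℝ)} {N' : (X' × ι → ℝ) →ₗ[ℝ] (X' × ι → ℝ)} {S : Set g.Site}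
    {hb : g.Site → ℝ} {β β₁ c₁ c₀ o₁ o₀ m₀ m₁ rA oAt cN rN o δ δN ε ℓ ω ρ : ℝ} (hβ : 0 ≤ β) (hβ₁ : 0 ≤ β₁) (hc₁ : 0 ≤ c₁) (hc₀ : 0 ≤ c₀) (ho₁ : 0 ≤ o₁) (ho₀ : 0 ≤ o₀)
    (hm₀ : 0 ≤ m₀) (hm₁ : 0 ≤ m₁) (hrA : 0 ≤ rA) (hoAt : 0 ≤ oAt) (hcN : 0 ≤ cN) (hrN : 0 ≤ rN) (ho : 0 ≤ o) (hℓ : 0 ≤ ℓ) (hω : 0 ≤ ω) (hε : 0 < ε) (hρ : 0 ≤ ρ)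
    (hρN : ρ ≤ δN - ε) (hρδ : ρ + σ ≤ δ)
    (hh1 : ∀ μ x, |fgrad n (τ μ) hX x| ≤ c₁) (hh1b : ∀ μ x, |bgrad n (τ μ) hX x| ≤ c₁) (hh0 : ∀ μ x, |hX (τ μ x) - hX x| ≤ c₀)
    (hh1' : ∀ μ x', |fgrad n' (τ' μ) hX' x'| ≤ c₁) (hh1b' : ∀ μ x', |bgrad n' (τ' μ) hX' x'| ≤ c₁) (hh0' : ∀ μ x', |hX' (τ' μ x') - hX' x'| ≤ c₀)
    (hf1 : ∀ μ x', |fgrad n' (τ' μ) hX' x' - fgrad n (τ μ) hX (π x')| ≤ o₁) (hf1b : ∀ μ x', |bgrad n' (τ' μ) hX' x' - bgrad n (τ μ) hX (π x')| ≤ o₁)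
    (hf0 : ∀ μ x', |(hX' (τ' μ x') - hX' x') - (hX (τ μ (π x')) - hX (π x'))| ≤ o₀)
    (hf0b : ∀ μ x', |(hX' x' - hX' ((τ' μ).symm x')) - (hX (π x') - hX ((τ μ).symm (π x')))| ≤ o₀)
    (hfit : ∀ x', |hX' x' - hX (π x')| ≤ o) (hLip : ∀ y y', |hb y - hb y'| ≤ ℓ * g.dist y y') (hrh : ∀ x, |hX x - hb (blk x)| ≤ ω) (hrh' : ∀ x', |hX' x' - hb (blk (π x'))| ≤ ω)
    (hA : ∀ j x i, ∑ k, |A j x i k| ≤ rA)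
    (hfAb : ∀ μ x' i, ∑ k, |A' (Sum.inl μ) ((τ' μ).symm x') i k - A (Sum.inl μ) ((τ μ).symm (π x')) i k| ≤ oAt)
    (hfAf : ∀ μ x' i, ∑ k, |A' (Sum.inr μ) (τ' μ x') i k - A (Sum.inr μ) (τ μ (π x')) i k| ≤ oAt)
    (hδf : ∀ μ x, hX x - hX ((τ μ).symm x) ≠ 0 → χX x = 1) (hδb : ∀ μ x, hX (τ μ x) - hX x ≠ 0 → χX x = 1)
    (hδf' : ∀ μ x', hX' x' - hX' ((τ' μ).symm x') ≠ 0 → χX' x' = 1) (hδb' : ∀ μ x', hX' (τ' μ x') - hX' x' ≠ 0 → χX' x' = 1)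
    (hsD : ∀ μ, G ∘ₗ fgrad n (liftEquiv (τ μ) ι) ∘ₗ mulOp (fun p : X × ι => χX p.1) = TD μ ∘ₗ mulOp (fun p : X × ι => χX p.1))
    (hsB : ∀ μ, G ∘ₗ bgrad n (liftEquiv (τ μ) ι) ∘ₗ mulOp (fun p : X × ι => χX p.1) = TB μ ∘ₗ mulOp (fun p : X × ι => χX p.1))
    (hsD' : ∀ μ, G' ∘ₗ fgrad n' (liftEquiv (τ' μ) ι) ∘ₗ mulOp (fun p : X' × ι => χX' p.1) = TD' μ ∘ₗ mulOp (fun p : X' × ι => χX' p.1))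
    (hsB' : ∀ μ, G' ∘ₗ bgrad n' (liftEquiv (τ' μ) ι) ∘ₗ mulOp (fun p : X' × ι => χX' p.1) = TB' μ ∘ₗ mulOp (fun p : X' × ι => χX' p.1))
    (hG' : HasMaj (BlockNorm.ofBlocks g (liftBlk blk ι ∘ liftMap π ι)) (BlockNorm.ofBlocks g (liftBlk blk ι ∘ liftMap π ι)) G'
      (fun y y' => ind S y * ind S y' * (β * Real.exp (-(δ * g.dist y y')))))
    (hTD' : ∀ μ, HasMaj (BlockNorm.ofBlocks g (liftBlk blk ι ∘ liftMap π ι)) (BlockNorm.ofBlocks g (liftBlk blk ι ∘ liftMap π ι)) (TD' μ)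
      (fun y y' => ind S y * ind S y' * (β₁ * Real.exp (-(δ * g.dist y y')))))
    (hTB' : ∀ μ, HasMaj (BlockNorm.ofBlocks g (liftBlk blk ι ∘ liftMap π ι)) (BlockNorm.ofBlocks g (liftBlk blk ι ∘ liftMap π ι)) (TB' μ)
      (fun y y' => ind S y * ind S y' * (β₁ * Real.exp (-(δ * g.dist y y')))))
    (hDG : HasMaj (BlockNorm.ofBlocks g (liftBlk blk ι)) (BlockNorm.ofBlocks g (liftBlk blk ι ∘ liftMap π ι)) (idef (pull (liftMap π ι)) (pull (liftMap π ι)) G' G)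
      (fun y y' => ind S y * ind S y' * (m₀ * Real.exp (-(δ * g.dist y y')))))
    (hDTD : ∀ μ, HasMaj (BlockNorm.ofBlocks g (liftBlk blk ι)) (BlockNorm.ofBlocks g (liftBlk blk ι ∘ liftMap π ι)) (idef (pull (liftMap π ι)) (pull (liftMap π ι)) (TD' μ) (TD μ))
      (fun y y' => ind S y * ind S y' * (m₁ * Real.exp (-(δ * g.dist y y')))))
    (hDTB : ∀ μ, HasMaj (BlockNorm.ofBlocks g (liftBlk blk ι)) (BlockNorm.ofBlocks g (liftBlk blk ι ∘ liftMap π ι)) (idef (pull (liftMap π ι)) (pull (liftMap π ι)) (TB' μ) (TB μ))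
      (fun y y' => ind S y * ind S y' * (m₁ * Real.exp (-(δ * g.dist y y')))))
    (hN : HasMaj (BlockNorm.ofBlocks g (liftBlk blk ι)) (BlockNorm.ofBlocks g (liftBlk blk ι)) N (fun y y' => cN * Real.exp (-(δN * g.dist y y'))))
    (hN' : HasMaj (BlockNorm.ofBlocks g (liftBlk blk ι ∘ liftMap π ι)) (BlockNorm.ofBlocks g (liftBlk blk ι ∘ liftMap π ι)) N' (fun y y' => cN * Real.exp (-(δN * g.dist y y'))))
    (hDN : HasMaj (BlockNorm.ofBlocks g (liftBlk blk ι)) (BlockNorm.ofBlocks g (liftBlk blk ι ∘ liftMap π ι)) (idef (pull (liftMap π ι)) (pull (liftMap π ι)) N' N)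
      (fun y y' => rN * Real.exp (-(δN * g.dist y y')))) :
    HasMaj (BlockNorm.ofBlocks g (liftBlk blk ι)) (BlockNorm.ofBlocks g (liftBlk blk ι ∘ liftMap π ι))
      (idef (pull (liftMap π ι)) (pull (liftMap π ι))
        (G' ∘ₗ commOp ((unstackM C' A' + N' ∘ₗ projO none) ∘ₗ
          stack LinearMap.id (fun j : J ⊕ J => Sum.elim (fun μ => fgrad n' (liftEquiv (τ' μ) ι)) (fun μ => bgrad n' (liftEquiv (τ' μ) ι)) j)) (fun p' : X' × ι => hX' p'.1))
        (G ∘ₗ commOp ((unstackM C A + N ∘ₗ projO none) ∘ₗ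
          stack LinearMap.id (fun j : J ⊕ J => Sum.elim (fun μ => fgrad n (liftEquiv (τ μ) ι)) (fun μ => bgrad n (liftEquiv (τ μ) ι)) j)) (fun p : X × ι => hX p.1)))
      (fun y y' => ind S y * ((Fintype.card J * (2 * (rA * (c₁ * m₀ + o₁ * β + c₀ * m₁ + o₀ * β₁) + oAt * (c₁ * β + c₀ * β₁))) +
          β * (((ℓ * (Real.exp 1 * ε)⁻¹ + 2 * ω) * rN + 2 * o * cN)) * cr + m₀ * ((ℓ * (Real.exp 1 * ε)⁻¹ + 2 * ω) * cN) * cr) * Real.exp (-(ρ * g.dist y y')))) := by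
  rw [unstackM_add_base_comp_jet, unstackM_add_base_comp_jet]
  exact hasMaj_idef_comp_commOp_speciesOpM_add_of_sandwich blk π τ τ' n n' C C' A A' hX hX' G G' htri hd hsymm hrow hσ hβ hβ₁ hc₁ hc₀ ho₁ ho₀ hm₀ hm₁ hrA hoAt hcN hrN ho hℓ hω hε hρ hρN hρδ
    hh1 hh1b hh0 hh1' hh1b' hh0' hf1 hf1b hf0 hf0b hfit hLip hrh hrh' hA hfAb hfAf hδf hδb hδf' hδb' hsD hsB hsD' hsB' hG' hTD' hTB' hDG hDTD hDTB hN hN' hDN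

end Summit.QuantumFields.YangMills.BalabanUVNodes.N15.Gluing

end
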